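import Literature.Geometry.Kaehler.ComplexTorusTranscendentalLatticeHardLefschetz
import HarnessLib

/-!
# The transcendental lattices `T^• = ⊕ₗ Tˡ` are a graded module over the integral Hodge ring `Hdg^•(X, ℤ)`,
# and `Hdgᵏ · Tˡ = 0` in top degree

Layer `Literature/Geometry/Kaehler`, namespace `Literature.Geometry.Kaehler.ComplexTorus`; lane `lit-hodgefound` (Track 2 foundations
library), seat p09, generation 34, row g34-#4. THEOREMS ONLY (0 definitions); no named fact, net debt 0. For a complex torus `X = E/Λ`
(`Φ : ℝ^ι ≃ E`, `n = |ι| = 2 dim_ℂ E`), the cup-product pairing `⟨γ, δ⟩_e = (γ ∧ δ)(λ_{e 0}, …, λ_{e(n−1)})` (`poincarePairing`) and the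
degree-`l` transcendental lattices of g31-#11 (`ComplexTorusTranscendentalLatticeAllDegrees`), written out exactly as there,
`Tˡ_{k,p} = Hˡ(X, ℤ) ∩ ⋂_{s ∈ Hdg^{k,p}(X, ℤ)} ker ⟨s, ·⟩_e` (`k + l = n`):

* §1 form algebra, ANY degrees, no parity hypothesis: **`⟨s, b ∧ x⟩_e = ⟨s ∧ b, x⟩_e`** (associativity of `∧`, the tree's discharged
  `ContinuousAlternatingMap.WedgeAssoc_holds`; the reindexing casts do not move the lattice tuple) and
  **`⟨s, x ∧ b⟩_e = (−1)^{jl} ⟨s ∧ b, x⟩_e`** (graded commutativity, `ContinuousAlternatingMap.WedgeComm_holds`); and for complementary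
  degrees `k + l = n`: **`⟨γ, δ⟩_e = 0 ⟺ γ ∧ δ = 0`** (a top-degree invariant form is detected by the lattice frame,
  `torusIntegral_eq_zero_iff`). The special cases `b = θʲ` (g31-#14 `poincarePairing_wedgePow_wedge_right`) and `b = pr₁^* vol`
  (`poincarePairing_comp_fst_volumeForm_wedge_right`) in the tree are instances and are not restated.
* §2 **`Hdg^{j,r}(X, ℤ) ∧ Tˡ_{a+j, p′+r} ⊆ T^{j+l}_{a, p′}`** and **`Tˡ_{a+j, p′+r} ∧ Hdg^{j,r}(X, ℤ) ⊆ T^{l+j}_{a, p′}`**: for an integral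
  Hodge class `b` of type `(r, r)` and `x ∈ Hˡ(X, ℤ)` annihilating `Hdg^{a+j, p′+r}(X, ℤ)`, the classes `b ∧ x`, `x ∧ b` annihilate
  `Hdg^{a,p′}(X, ℤ)` (`⟨s, b ∧ x⟩ = ⟨s ∧ b, x⟩ = 0` because `s ∧ b ∈ Hdg^{a+j, p′+r}(X, ℤ)`: the integral Hodge classes form a
  bigraded ring, g31-#1 `wedge_mem_integralHodgeClassesIn`) — i.e. `T^•` is a graded `Hdg^•(X, ℤ)`-submodule of `H^•(X, ℤ)`; as a
  `ℤ`-bilinear map `Hdg^{j,r}(X, ℤ) × Tˡ → T^{j+l}`, as an inclusion of subgroups, and the rational companion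
  `B^{j,r}(X) ∧ Tˡ_ℚ ⊆ T^{j+l}_ℚ` for the `ℚ`-annihilators.
* §3 complementary degrees `k + l = n`: **`s ∧ x = 0` and `x ∧ s = 0` in `Hⁿ(X) ≅ ℂ · vol`** for every rational Hodge class
  `s ∈ B^{k,p}(X)` and every `x ∈ Tˡ_{k,p}` (`⟨s, x⟩ = 0`, g31-#11, and §1) — the every-degree form of the surface statement
  `T_X · S_X = 0` (Shioda–Mitani (1.5); the tree's `wedge_eq_zero_of_mem_transcendentalLattice` for `H²` of a `2`-torus).

## References

* [cite: Huybrechts2016K3, Ch. 3 §2.2 Def. 2.5 and Lemma 3.1 (PDF pp. 58–60): `T(X) = NS(X)^⊥`, orthogonality to all Hodge classes]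
* [cite: VoisinHodgeI2002, §6.1.3 Cor. 6.15 (PDF p. 122: the cup product is bigraded for the Hodge bigrading); §7.1.2 (PDF p. 134); §11.3.1 Def. 11.28]
* [cite: Lange2023AbelianVarietiesComplex, §1.4.1 (p. 37: `H^•(X, ℤ) = ⋀^• Hom(Λ, ℤ)` as a ring); §6.2.4 (6.10) (p. 310); §7.3.1 (the Hodge ring)]
* [cite: ShiodaMitani1974, §1 (1.5)]
* [cite: Warner1983, 2.6 and 2.10 (associativity and graded commutativity of `∧`)]
-/

noncomputable section

open Module Function

namespace Literature.Geometry.Kaehler.ComplexTorus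

section HodgeModule

variable {ι : Type*} [Fintype ι] [DecidableEq ι] {E : Type*} [NormedAddCommGroup E] [NormedSpace ℂ E]
  (Φ : (ι → ℝ) ≃L[ℝ] E) {n : ℕ} (e : Fin n ≃ ι)

/-! ## §1 Form algebra under the cup-product pairing -/

omit [Fintype ι] in
/-- **`⟨s, b ∧ x⟩_e = ⟨s ∧ b, x⟩_e`** for forms of ANY degrees `a, j, l` with `a + j + l = n`: associativity of the wedge product
(`s ∧ (b ∧ x) = (s ∧ b) ∧ x` up to the reindexing `Fin (a + (j + l)) ≃ Fin (a + j + l)`, which does not change the lattice tuple the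
pairing evaluates on). [cite: Warner1983, 2.6] [cite: Lange2023AbelianVarietiesComplex, §1.4.1 (p. 37) and §6.2.4 (p. 310)] -/
theorem poincarePairing_wedge_right {a j l : ℕ} (h₁ : a + (j + l) = n) (h₂ : a + j + l = n)
    (s : E [⋀^Fin a]→L[ℝ] ℂ) (b : E [⋀^Fin j]→L[ℝ] ℂ) (x : E [⋀^Fin l]→L[ℝ] ℂ) :
    poincarePairing Φ e h₁ s (b.wedge x) = poincarePairing Φ e h₂ (s.wedge b) x := by
  simp only [poincarePairing_apply]
  have hA := ContinuousAlternatingMap.WedgeAssoc_holds ℝ E ℂ s b x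
  have hev := congrArg (fun φ : E [⋀^Fin (a + j + l)]→L[ℝ] ℂ ↦ φ (orderedBasis Φ e ∘ Fin.cast h₂)) hA
  simp only [ContinuousAlternatingMap.domDomCongr_apply] at hev
  convert hev.symm using 2
  exact funext fun _ ↦ rfl

omit [Fintype ι] in
/-- **`⟨s ∧ b, x⟩_e = ⟨s, b ∧ x⟩_e`** (the same associativity, read from the left factor). [cite: Warner1983, 2.6] -/
theorem poincarePairing_wedge_left {a j l : ℕ} (h₁ : a + j + l = n) (h₂ : a + (j + l) = n)
    (s : E [⋀^Fin a]→L[ℝ] ℂ) (b : E [⋀^Fin j]→L[ℝ] ℂ) (x : E [⋀^Fin l]→L[ℝ] ℂ) :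
    poincarePairing Φ e h₁ (s.wedge b) x = poincarePairing Φ e h₂ s (b.wedge x) :=
  (poincarePairing_wedge_right Φ e h₂ h₁ s b x).symm

omit [Fintype ι] in
/-- **`⟨s, x ∧ b⟩_e = (−1)^{jl} · ⟨s ∧ b, x⟩_e`** (`deg b = j`, `deg x = l`): graded commutativity `x ∧ b = (−1)^{jl} b ∧ x` followed by
associativity. [cite: Warner1983, 2.6 and 2.10] [cite: Lange2023AbelianVarietiesComplex, §1.4.1 (p. 37)] -/
theorem poincarePairing_wedge_right_comm {a j l : ℕ} (h₁ : a + (l + j) = n) (h₂ : a + j + l = n)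
    (s : E [⋀^Fin a]→L[ℝ] ℂ) (b : E [⋀^Fin j]→L[ℝ] ℂ) (x : E [⋀^Fin l]→L[ℝ] ℂ) :
    poincarePairing Φ e h₁ s (x.wedge b) = (-1 : ℂ) ^ (j * l) * poincarePairing Φ e h₂ (s.wedge b) x := by
  rw [← poincarePairing_wedge_right Φ e (by omega : a + (j + l) = n) h₂ s b x]
  simp only [poincarePairing_apply]
  rw [ContinuousAlternatingMap.WedgeComm_holds ℝ E ℂ b x, ContinuousAlternatingMap.wedge_smul_right,
    wedge_domDomCongr_finCongr (Nat.add_comm j l) s (b.wedge x), ContinuousAlternatingMap.smul_apply,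
    ContinuousAlternatingMap.domDomCongr_apply, Complex.real_smul, Complex.ofReal_pow, Complex.ofReal_neg,
    Complex.ofReal_one]
  exact congrArg ((-1 : ℂ) ^ (j * l) * ·) (congrArg _ (funext fun _ ↦ rfl))

omit [Fintype ι] in
/-- The orientation sign `±1` of a lattice frame is a non-zero complex number. [cite: Lange2023AbelianVarietiesComplex, §6.2.4 (p. 310)] -/
private theorem orientationSign_cast_ne_zero₃₄ {m : ℕ} (f : Fin m ≃ ι) : (orientationSign Φ f : ℂ) ≠ 0 := by
  rcases orientationSign_eq_or Φ f with h | h <;> rw [h] <;> norm_num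

/-- **`⟨γ, δ⟩_e = 0 ⟺ γ ∧ δ = 0`** for complementary degrees `k + l = n`: the pairing is the value of the top-degree form `γ ∧ δ` on the
lattice frame (up to the sign `±1`), and a translation-invariant top-degree form vanishing on a frame is zero
(`∫_X γ ∧ δ = ± ⟨γ, δ⟩_e`, `torusIntegral_eq_zero_iff`). [cite: Lange2023AbelianVarietiesComplex, §6.2.4 (6.10) (p. 310) and §1.4.1 (p. 37)] -/
theorem poincarePairing_eq_zero_iff_wedge_eq_zero {k l : ℕ} (h : k + l = n) (γ : E [⋀^Fin k]→L[ℝ] ℂ)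
    (δ : E [⋀^Fin l]→L[ℝ] ℂ) : poincarePairing Φ e h γ δ = 0 ↔ γ.wedge δ = 0 := by
  rw [← torusIntegral_eq_zero_iff Φ ((finCongr h).trans e) (γ.wedge δ),
    torusIntegral_wedge_eq_orientationSign_mul_poincarePairing Φ e h γ δ, mul_eq_zero,
    or_iff_right (orientationSign_cast_ne_zero₃₄ Φ ((finCongr h).trans e))]

/-! ## §2 `Hdg^{j,r}(X, ℤ) ∧ Tˡ ⊆ T^{j+l}` and `Tˡ ∧ Hdg^{j,r}(X, ℤ) ⊆ T^{l+j}`: `T^•` is a graded `Hdg^•(X, ℤ)`-module -/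

omit [Fintype ι] in
/-- **`Hdg^{j,r}(X, ℤ) ∧ Tˡ_{a+j, p′+r} ⊆ T^{j+l}_{a,p′}`**: for an integral Hodge class `b ∈ Hdg^{j,r}(X, ℤ)` and `x ∈ Hˡ(X, ℤ)` annihilating
`Hdg^{a+j, p′+r}(X, ℤ)`, the class `b ∧ x ∈ H^{j+l}(X, ℤ)` annihilates `Hdg^{a,p′}(X, ℤ)`: `⟨s, b ∧ x⟩ = ⟨s ∧ b, x⟩ = 0`, since
`s ∧ b ∈ Hdg^{a+j, p′+r}(X, ℤ)` (the integral Hodge classes form a bigraded ring, g31-#1 `wedge_mem_integralHodgeClassesIn`) — the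
transcendental lattices form a graded module over the integral Hodge ring. The cases `b = θʲ` (`wedgePow_wedge_mem_integralHodgeAnnihilator`)
and `b = pr₁^* vol_{X₁}` (`comp_fst_volumeForm_wedge_mem_integralHodgeAnnihilator`) are in the tree.
[cite: Huybrechts2016K3, Ch. 3 §2.2 Def. 2.5 (PDF p. 58)] [cite: VoisinHodgeI2002, §6.1.3 Cor. 6.15 (PDF p. 122) and §11.3.1 Def. 11.28]
[cite: Lange2023AbelianVarietiesComplex, §7.3.1 and §6.2.4 (p. 310)] -/
theorem wedge_mem_integralHodgeAnnihilator {a j l r p' : ℕ} (h₁ : a + j + l = n) (h₂ : a + (j + l) = n)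
    {b : E [⋀^Fin j]→L[ℝ] ℂ} (hb : b ∈ integralHodgeClassesIn Φ j r) {x : E [⋀^Fin l]→L[ℝ] ℂ}
    (hx : x ∈ integralForms Φ l ⊓ ⨅ s : integralHodgeClassesIn Φ (a + j) (p' + r),
        (LinearMap.ker (poincarePairing Φ e h₁ (s : E [⋀^Fin (a + j)]→L[ℝ] ℂ))).toAddSubgroup) :
    b.wedge x ∈ integralForms Φ (j + l) ⊓ ⨅ s : integralHodgeClassesIn Φ a p',
        (LinearMap.ker (poincarePairing Φ e h₂ (s : E [⋀^Fin a]→L[ℝ] ℂ))).toAddSubgroup := by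
  rw [mem_integralHodgeAnnihilator_iff] at hx ⊢
  refine ⟨wedge_mem_integralForms Φ ((mem_integralHodgeClassesIn_iff Φ).1 hb).1 hx.1, fun s hs ↦ ?_⟩
  rw [poincarePairing_wedge_right Φ e h₂ h₁ s b x]
  exact hx.2 _ (wedge_mem_integralHodgeClassesIn Φ hs hb)

omit [Fintype ι] in
/-- **`Tˡ_{a+j, p′+r} ∧ Hdg^{j,r}(X, ℤ) ⊆ T^{l+j}_{a,p′}`**: the same with the Hodge class on the right
(`⟨s, x ∧ b⟩ = ± ⟨s ∧ b, x⟩ = 0`). [cite: Huybrechts2016K3, Ch. 3 §2.2 Def. 2.5 (PDF p. 58)] [cite: VoisinHodgeI2002, §6.1.3 Cor. 6.15 (PDF p. 122)]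
[cite: Lange2023AbelianVarietiesComplex, §7.3.1] -/
theorem wedge_mem_integralHodgeAnnihilator_left {a j l r p' : ℕ} (h₁ : a + j + l = n) (h₃ : a + (l + j) = n)
    {b : E [⋀^Fin j]→L[ℝ] ℂ} (hb : b ∈ integralHodgeClassesIn Φ j r) {x : E [⋀^Fin l]→L[ℝ] ℂ}
    (hx : x ∈ integralForms Φ l ⊓ ⨅ s : integralHodgeClassesIn Φ (a + j) (p' + r),
        (LinearMap.ker (poincarePairing Φ e h₁ (s : E [⋀^Fin (a + j)]→L[ℝ] ℂ))).toAddSubgroup) :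
    x.wedge b ∈ integralForms Φ (l + j) ⊓ ⨅ s : integralHodgeClassesIn Φ a p',
        (LinearMap.ker (poincarePairing Φ e h₃ (s : E [⋀^Fin a]→L[ℝ] ℂ))).toAddSubgroup := by
  rw [mem_integralHodgeAnnihilator_iff] at hx ⊢
  refine ⟨wedge_mem_integralForms Φ hx.1 ((mem_integralHodgeClassesIn_iff Φ).1 hb).1, fun s hs ↦ ?_⟩
  rw [poincarePairing_wedge_right_comm Φ e h₃ h₁ s b x, hx.2 _ (wedge_mem_integralHodgeClassesIn Φ hs hb), mul_zero]

omit [Fintype ι] in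
/-- **`b ∧ Tˡ_{a+j, p′+r} ≤ T^{j+l}_{a,p′}` as an inclusion of subgroups of `H^{j+l}(X, ℂ)`**, for each `b ∈ Hdg^{j,r}(X, ℤ)` (the image of
the transcendental lattice under the additive map `x ↦ b ∧ x`). [cite: Huybrechts2016K3, Ch. 3 §2.2 Def. 2.5 (PDF p. 58)]
[cite: Lange2023AbelianVarietiesComplex, §7.3.1] -/
theorem map_wedge_integralHodgeAnnihilator_le {a j l r p' : ℕ} (h₁ : a + j + l = n) (h₂ : a + (j + l) = n)
    {b : E [⋀^Fin j]→L[ℝ] ℂ} (hb : b ∈ integralHodgeClassesIn Φ j r) :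
    (integralForms Φ l ⊓ ⨅ s : integralHodgeClassesIn Φ (a + j) (p' + r),
        (LinearMap.ker (poincarePairing Φ e h₁ (s : E [⋀^Fin (a + j)]→L[ℝ] ℂ))).toAddSubgroup).map
      (AddMonoidHom.mk' (fun x : E [⋀^Fin l]→L[ℝ] ℂ ↦ b.wedge x) (ContinuousAlternatingMap.wedge_add_right b)) ≤
    integralForms Φ (j + l) ⊓ ⨅ s : integralHodgeClassesIn Φ a p',
        (LinearMap.ker (poincarePairing Φ e h₂ (s : E [⋀^Fin a]→L[ℝ] ℂ))).toAddSubgroup := by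
  rintro _ ⟨x, hx, rfl⟩
  exact wedge_mem_integralHodgeAnnihilator Φ e h₁ h₂ hb hx

omit [Fintype ι] in
/-- **The module structure as a `ℤ`-bilinear map `Hdg^{j,r}(X, ℤ) × Tˡ_{a+j, p′+r} → T^{j+l}_{a,p′}, (b, x) ↦ b ∧ x`.**
[cite: Huybrechts2016K3, Ch. 3 §2.2 Def. 2.5 (PDF p. 58)] [cite: VoisinHodgeI2002, §6.1.3 Cor. 6.15 (PDF p. 122)]
[cite: Lange2023AbelianVarietiesComplex, §7.3.1] -/
theorem exists_intBilinMap_integralHodgeClassesIn_wedge_integralHodgeAnnihilator {a j l r p' : ℕ} (h₁ : a + j + l = n)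
    (h₂ : a + (j + l) = n) :
    ∃ M : ↥(integralHodgeClassesIn Φ j r) →ₗ[ℤ]
        ↥(integralForms Φ l ⊓ ⨅ s : integralHodgeClassesIn Φ (a + j) (p' + r),
          (LinearMap.ker (poincarePairing Φ e h₁ (s : E [⋀^Fin (a + j)]→L[ℝ] ℂ))).toAddSubgroup) →ₗ[ℤ]
        ↥(integralForms Φ (j + l) ⊓ ⨅ s : integralHodgeClassesIn Φ a p',
          (LinearMap.ker (poincarePairing Φ e h₂ (s : E [⋀^Fin a]→L[ℝ] ℂ))).toAddSubgroup),
      ∀ b x, (M b x : E [⋀^Fin (j + l)]→L[ℝ] ℂ) = (b : E [⋀^Fin j]→L[ℝ] ℂ).wedge (x : E [⋀^Fin l]→L[ℝ] ℂ) := by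
  refine ⟨LinearMap.mk₂ ℤ
      (fun b x ↦ ⟨(b : E [⋀^Fin j]→L[ℝ] ℂ).wedge (x : E [⋀^Fin l]→L[ℝ] ℂ),
        wedge_mem_integralHodgeAnnihilator Φ e h₁ h₂ b.2 x.2⟩)
      (fun _ _ _ ↦ Subtype.ext (ContinuousAlternatingMap.wedge_add_left _ _ _))
      (fun c b x ↦ Subtype.ext ?_)
      (fun _ _ _ ↦ Subtype.ext (ContinuousAlternatingMap.wedge_add_right _ _ _))
      (fun c b x ↦ Subtype.ext ?_), fun _ _ ↦ rfl⟩
  · change (c • (b : E [⋀^Fin j]→L[ℝ] ℂ)).wedge (x : E [⋀^Fin l]→L[ℝ] ℂ) =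
      c • (b : E [⋀^Fin j]→L[ℝ] ℂ).wedge (x : E [⋀^Fin l]→L[ℝ] ℂ)
    exact map_zsmul (AddMonoidHom.mk' (fun β : E [⋀^Fin j]→L[ℝ] ℂ ↦ β.wedge (x : E [⋀^Fin l]→L[ℝ] ℂ))
      fun _ _ ↦ ContinuousAlternatingMap.wedge_add_left _ _ _) c _
  · change (b : E [⋀^Fin j]→L[ℝ] ℂ).wedge (c • (x : E [⋀^Fin l]→L[ℝ] ℂ)) =
      c • (b : E [⋀^Fin j]→L[ℝ] ℂ).wedge (x : E [⋀^Fin l]→L[ℝ] ℂ)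
    exact map_zsmul (AddMonoidHom.mk' (fun ξ : E [⋀^Fin l]→L[ℝ] ℂ ↦ (b : E [⋀^Fin j]→L[ℝ] ℂ).wedge ξ)
      (ContinuousAlternatingMap.wedge_add_right _)) c _

/-- **Rational companion: `B^{j,r}(X) ∧ Tˡ_ℚ ⊆ T^{j+l}_ℚ`** — for a RATIONAL Hodge class `b ∈ B^{j,r}(X)` and a rational class `x`
annihilating `Hdg^{a+j, p′+r}(X, ℤ)`, the class `b ∧ x` is rational and annihilates `Hdg^{a,p′}(X, ℤ)` (`⟨s, b ∧ x⟩ = ⟨s ∧ b, x⟩`, and the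
rational Hodge class `s ∧ b` has a positive integral multiple in `Hdg^{a+j, p′+r}(X, ℤ)`, `exists_nsmul_mem_integralHodgeClassesIn`).
[cite: Huybrechts2016K3, Ch. 3 §2.2 Def. 2.5 and Lemma 3.1 (PDF pp. 58–60)] [cite: VoisinHodgeI2002, §6.1.3 Cor. 6.15 (PDF p. 122) and §11.3.1 Def. 11.28] -/
theorem wedge_mem_rationalHodgeAnnihilator {a j l r p' : ℕ} (h₁ : a + j + l = n) (h₂ : a + (j + l) = n)
    {b : E [⋀^Fin j]→L[ℝ] ℂ} (hb : b ∈ hodgeClassesIn Φ j r) {x : E [⋀^Fin l]→L[ℝ] ℂ}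
    (hx : x ∈ rationalForms Φ l ⊓ ⨅ s : integralHodgeClassesIn Φ (a + j) (p' + r),
        (LinearMap.ker (poincarePairing Φ e h₁ (s : E [⋀^Fin (a + j)]→L[ℝ] ℂ))).restrictScalars ℚ) :
    b.wedge x ∈ rationalForms Φ (j + l) ⊓ ⨅ s : integralHodgeClassesIn Φ a p',
        (LinearMap.ker (poincarePairing Φ e h₂ (s : E [⋀^Fin a]→L[ℝ] ℂ))).restrictScalars ℚ := by
  simp only [Submodule.mem_inf, Submodule.mem_iInf, Submodule.restrictScalars_mem, LinearMap.mem_ker, Subtype.forall] at hx ⊢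
  refine ⟨wedge_mem_rationalForms Φ hb.1 hx.1, fun s hs ↦ ?_⟩
  rw [poincarePairing_wedge_right Φ e h₂ h₁ s b x]
  classical
  letI : LinearOrder ι := LinearOrder.lift' (Fintype.equivFin ι) (Fintype.equivFin ι).injective
  obtain ⟨N, hN, hNsb⟩ := exists_nsmul_mem_integralHodgeClassesIn Φ
    (wedge_mem_hodgeClassesIn Φ (integralHodgeClassesIn_subset_hodgeClassesIn Φ a p' hs) hb)
  have h0 : (N : ℂ) • poincarePairing Φ e h₁ (s.wedge b) x = 0 := by
    rw [← LinearMap.map_smul₂]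
    exact hx.2 _ hNsb
  rw [smul_eq_mul, mul_eq_zero] at h0
  exact h0.resolve_left (by exact_mod_cast hN.ne')

/-! ## §3 Complementary degrees `k + l = n`: `B^{k,p}(X) ∧ Tˡ_{k,p} = 0` in `Hⁿ(X)` -/

/-- **`s ∧ x = 0` for `s ∈ B^{k,p}(X)` and `x ∈ Tˡ_{k,p}`, `k + l = n`**: the top-degree class `s ∧ x ∈ Hⁿ(X) = ℂ · vol` has
`∫_X s ∧ x = ± ⟨s, x⟩_e = 0` (g31-#11 `poincarePairing_eq_zero_of_mem_hodgeClassesIn_of_mem_integralHodgeAnnihilator` and §1). The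
every-degree form of `T_X · S_X = 0` for surfaces. [cite: ShiodaMitani1974, §1 (1.5)] [cite: Huybrechts2016K3, Ch. 3 §2.2 Def. 2.5 and Lemma 3.1 (PDF pp. 58–60)]
[cite: Lange2023AbelianVarietiesComplex, §6.2.4 (6.10) (p. 310)] -/
theorem wedge_eq_zero_of_mem_hodgeClassesIn_of_mem_integralHodgeAnnihilator {k l p : ℕ} (h : k + l = n)
    {s : E [⋀^Fin k]→L[ℝ] ℂ} (hs : s ∈ hodgeClassesIn Φ k p) {x : E [⋀^Fin l]→L[ℝ] ℂ}
    (hx : x ∈ integralForms Φ l ⊓ ⨅ t : integralHodgeClassesIn Φ k p,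
        (LinearMap.ker (poincarePairing Φ e h (t : E [⋀^Fin k]→L[ℝ] ℂ))).toAddSubgroup) :
    s.wedge x = 0 :=
  (poincarePairing_eq_zero_iff_wedge_eq_zero Φ e h s x).1
    (poincarePairing_eq_zero_of_mem_hodgeClassesIn_of_mem_integralHodgeAnnihilator Φ e h p hx hs)

/-- **`s ∧ x = 0` for an INTEGRAL Hodge class `s ∈ Hdg^{k,p}(X, ℤ)` and `x ∈ Tˡ_{k,p}`**, `k + l = n`.
[cite: ShiodaMitani1974, §1 (1.5)] [cite: Huybrechts2016K3, Ch. 3 §2.2 Def. 2.5 (PDF p. 58)] -/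
theorem wedge_eq_zero_of_mem_integralHodgeClassesIn_of_mem_integralHodgeAnnihilator {k l p : ℕ} (h : k + l = n)
    {s : E [⋀^Fin k]→L[ℝ] ℂ} (hs : s ∈ integralHodgeClassesIn Φ k p) {x : E [⋀^Fin l]→L[ℝ] ℂ}
    (hx : x ∈ integralForms Φ l ⊓ ⨅ t : integralHodgeClassesIn Φ k p,
        (LinearMap.ker (poincarePairing Φ e h (t : E [⋀^Fin k]→L[ℝ] ℂ))).toAddSubgroup) :
    s.wedge x = 0 :=
  wedge_eq_zero_of_mem_hodgeClassesIn_of_mem_integralHodgeAnnihilator Φ e h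
    (integralHodgeClassesIn_subset_hodgeClassesIn Φ k p hs) hx

/-- **`x ∧ s = 0` for `s ∈ B^{k,p}(X)` and `x ∈ Tˡ_{k,p}`**, `k + l = n` (graded commutativity `x ∧ s = ± s ∧ x`).
[cite: ShiodaMitani1974, §1 (1.5)] [cite: Huybrechts2016K3, Ch. 3 §2.2 Def. 2.5 (PDF p. 58)] [cite: Warner1983, 2.10] -/
theorem wedge_eq_zero_of_mem_integralHodgeAnnihilator_of_mem_hodgeClassesIn {k l p : ℕ} (h : k + l = n)
    {x : E [⋀^Fin l]→L[ℝ] ℂ} (hx : x ∈ integralForms Φ l ⊓ ⨅ t : integralHodgeClassesIn Φ k p,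
        (LinearMap.ker (poincarePairing Φ e h (t : E [⋀^Fin k]→L[ℝ] ℂ))).toAddSubgroup)
    {s : E [⋀^Fin k]→L[ℝ] ℂ} (hs : s ∈ hodgeClassesIn Φ k p) : x.wedge s = 0 := by
  rw [ContinuousAlternatingMap.WedgeComm_holds ℝ E ℂ s x,
    wedge_eq_zero_of_mem_hodgeClassesIn_of_mem_integralHodgeAnnihilator Φ e h hs hx]
  ext v
  simp

/-- **`⟨x ∧ s⟩`-form with an integral Hodge class: `x ∧ s = 0` for `s ∈ Hdg^{k,p}(X, ℤ)`, `x ∈ Tˡ_{k,p}`**, `k + l = n`.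
[cite: ShiodaMitani1974, §1 (1.5)] [cite: Huybrechts2016K3, Ch. 3 §2.2 Def. 2.5 (PDF p. 58)] -/
theorem wedge_eq_zero_of_mem_integralHodgeAnnihilator_of_mem_integralHodgeClassesIn {k l p : ℕ} (h : k + l = n)
    {x : E [⋀^Fin l]→L[ℝ] ℂ} (hx : x ∈ integralForms Φ l ⊓ ⨅ t : integralHodgeClassesIn Φ k p,
        (LinearMap.ker (poincarePairing Φ e h (t : E [⋀^Fin k]→L[ℝ] ℂ))).toAddSubgroup)
    {s : E [⋀^Fin k]→L[ℝ] ℂ} (hs : s ∈ integralHodgeClassesIn Φ k p) : x.wedge s = 0 :=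
  wedge_eq_zero_of_mem_integralHodgeAnnihilator_of_mem_hodgeClassesIn Φ e h hx
    (integralHodgeClassesIn_subset_hodgeClassesIn Φ k p hs)

end HodgeModule

end Literature.Geometry.Kaehler.ComplexTorus
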